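import Mathlib
import Literature.MathematicalPhysics.QuantumFieldTheory.Balaban1983to89.SchurTest
import Literature.MathematicalPhysics.QuantumFieldTheory.Balaban1983to89.B9Thm311
import Literature.LinearAlgebra.Matrix.HornerSymmetrizer

/-! # `Balaban1983to89.QGQInverse` — the inversion step behind B9 (3.132) / B11 (130): coercivity + kernel decay
⇒ decay of the inverse kernel (finite Combes–Thomas argument), and the variational lower bound, kernel-checked

CITATION HEADER. Supports the reading (unit `b2b-balaban-r1-g3`, reader group A gen 3, cell pub-balaban) of
T. Balaban, *Propagators for lattice gauge theories in a background field*, Commun. Math. Phys. 99 (1985) 389–434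
[`Balaban1985BackgroundPropagators`] (= B9), p. 422 [PDF 34], the sentence and display before Theorem 3.12
(render `1985-cmp99-background-propagators-p034-x2.png`): *"(QGQ*)^{−1} … can be analyzed in the same way as the
operator (Q′G′²Q′*)^{−1}. We will not repeat these considerations here. Let us write only bounds. We have
|(QGQ*)^{−1}(y, y′)| ≤ O(1)(L^jη)^{−2}(L^{j′}η)^{−d}e^{−δ₁d(y,y′)} (3.132) … and the same for the operator with G₁"*
(tree leaf `B9.Ineq3132` / `B9.Stmt3132Printed`; GAPS G-B9-15), and of its consumer T. Balaban, *The variational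
problem and background fields in renormalization group method for lattice gauge theories*, Commun. Math. Phys. 102
(1985) 277–309 [`Balaban1985VariationalBackground`] (= B11), pp. 297–298 [PDF 21–22] (129)–(130):
*"H₀B = GQ*(QGQ*)^{−1}(L^{j(·)}η)^{−1}B, (129) and satisfies the bound (3.133) [5] with the additional inequality for the
covariant Laplace operator … (130)"* with *"Δ_a = Δ + DRD* + Q*aQ (the constant a = 1). For the operator Δ_a^{−1} = G
we have proved Theorem 3.3 in [5]"* (GAPS G-IF-02; INTERFACES-A IF-A-05): a (3.132)-type bound for (QG₀Q*)^{−1},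
G₀ = Δ_a^{−1} in the Sect. A–C sense of B9, is printed nowhere.

WHAT THIS FILE CERTIFIES (kernel; finite index set, real scalars — the normalised matrix S̃ = D^{−1}W^{1/2}(QGQ*)W^{1/2}
D^{−1} of the written repair `HOME/b2b-balaban-r1/QGQ-inverse-proof.md`, §§3–6):
1. `inv_entry_le_of_coercive` — a coercive matrix (`γ‖x‖² ≤ ⟨x, Sx⟩`, `γ > 0`) is invertible and every entry of
   its inverse is bounded by `γ⁻¹`.
2. `inv_entry_le_of_conj_coercive` — Combes–Thomas conjugation: if the conjugated matrix
   `S_f(i,j) = e^{f i − f j} S(i,j)` is coercive with constant `γ`, then `|S⁻¹(i,j)| ≤ γ⁻¹ e^{−(f i − f j)}`.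
3. `form_abs_le_of_schur` — the quadratic form of a matrix with absolute row sums ≤ R and column sums ≤ C is
   bounded by `ρ‖x‖²` whenever `R C ≤ ρ²` (finite Schur test, `SchurTest.sum_sq_le`).
4. `inverse_decay` — THE MECHANISM: `S` coercive (`γ`), `d` a pseudo-metric on the index set, and the weighted
   absolute row and column sums `Σ_j |S(i,j)| (e^{κ d(i,j)} − 1) ≤ ρ < γ` imply
   `|S⁻¹(i,j)| ≤ (γ − ρ)⁻¹ e^{−κ d(i,j)}` for all `i, j`.
5. `two_dot_sub_form_le_inv_form` / `qgq_form_lower_of_test` / `qgq_coercive_of_approx_right_inverse` — the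
   variational inequality
   `2⟨QA, λ⟩ − ⟨A, ΔA⟩ ≤ ⟨λ, QΔ⁻¹Qᵀλ⟩` for a symmetric positive-definite `Δ`, every rectangular `Q` and EVERY
   test field `A`: the device by which the written repair obtains the coercivity of the normalised QGQ* from one
   explicit test field per λ (an approximate smooth right inverse of the averaging operator), i.e. from an UPPER
   bound on the quadratic form ⟨A, Δ_aA⟩ — never from Δ_a's inverse.
WHAT IT DOES NOT CERTIFY: the two analytic inputs of the written repair — (II.a) the kernel decay of QG₀Q* (from
B9 Theorem 3.3, printed, tree `B9.Thm33Printed`, plus B6 Lemma 2.1, tree `B6.Lemma21Printed`) and (II.b) the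
energy bound for the explicit test fields (Lemma P′ of the written repair, elementary lattice analysis in the gauges of
B9 (3.35)) — and the multiscale normalisation bookkeeping (B6 Lemma 2.1 (2.60)–(2.61)); those are written, with page
references, in `QGQ-inverse-proof.md`, which also records the census of the printed "same way" route (B6 Prop. 2.7 at
U = 1 → undisplayed Sect. B perturbation → gauge covariance → Sect. C gluing inheriting GAPS G-B9-05/08).
Elementary; [folklore] (Combes–Thomas / Demko–Moss–Smith decay of inverses of well-conditioned banded or
exponentially localised matrices; Schur test; Schur-complement variational principle). -/

namespace Literature.MathematicalPhysics.QuantumFieldTheory.Balaban1983to89.QGQInverse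

open Matrix Finset

variable {n : Type*} [Fintype n] [DecidableEq n]

/-! ## Coercive matrices -/

/-- `Coercive S γ`: the real quadratic form of `S` dominates `γ‖x‖²`. [folklore] -/
def Coercive (S : Matrix n n ℝ) (γ : ℝ) : Prop :=
  ∀ x : n → ℝ, γ * (x ⬝ᵥ x) ≤ x ⬝ᵥ (S *ᵥ x)

/- `0 ≤ v ⬝ᵥ v` and Cauchy–Schwarz for real vectors are reused from the tree:
`Literature.LinearAlgebra.Matrix.dotProduct_self_nonneg_real`, `B9Thm311.dot_sq_le`. -/

/-- A coercive matrix with `γ > 0` has injective `mulVec`, hence is a unit. [folklore] -/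
theorem isUnit_of_coercive {S : Matrix n n ℝ} {γ : ℝ} (hγ : 0 < γ) (h : Coercive S γ) : IsUnit S := by
  rw [← Matrix.mulVec_injective_iff_isUnit]
  intro x y hxy
  have h0 : S *ᵥ (x - y) = 0 := by rw [Matrix.mulVec_sub, hxy, sub_self]
  have hc := h (x - y)
  rw [h0, dotProduct_zero] at hc
  have hnn : 0 ≤ (x - y) ⬝ᵥ (x - y) := Literature.LinearAlgebra.Matrix.dotProduct_self_nonneg_real _
  have hz : (x - y) ⬝ᵥ (x - y) = 0 := by
    have : (x - y) ⬝ᵥ (x - y) ≤ 0 := by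
      by_contra hpos
      push Not at hpos
      have := mul_pos hγ hpos
      linarith
    exact le_antisymm this hnn
  exact sub_eq_zero.mp (dotProduct_self_eq_zero.mp hz)

/-- For a coercive `S` (`γ > 0`): `γ² ‖S⁻¹ y‖² ≤ ‖y‖²`. [folklore] -/
theorem inv_mulVec_sq_le {S : Matrix n n ℝ} {γ : ℝ} (hγ : 0 < γ) (h : Coercive S γ) (y : n → ℝ) :
    γ ^ 2 * ((S⁻¹ *ᵥ y) ⬝ᵥ (S⁻¹ *ᵥ y)) ≤ y ⬝ᵥ y := by
  set x := S⁻¹ *ᵥ y with hx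
  have hU : IsUnit S.det := (Matrix.isUnit_iff_isUnit_det S).mp (isUnit_of_coercive hγ h)
  have hSx : S *ᵥ x = y := by
    rw [hx, Matrix.mulVec_mulVec, Matrix.mul_nonsing_inv S hU, Matrix.one_mulVec]
  have hc : γ * (x ⬝ᵥ x) ≤ x ⬝ᵥ y := by simpa [hSx] using h x
  have hxx : 0 ≤ x ⬝ᵥ x := Literature.LinearAlgebra.Matrix.dotProduct_self_nonneg_real x
  have hcs : (x ⬝ᵥ y) ^ 2 ≤ (x ⬝ᵥ x) * (y ⬝ᵥ y) := B9Thm311.dot_sq_le x y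
  have h1 : (γ * (x ⬝ᵥ x)) ^ 2 ≤ (x ⬝ᵥ y) ^ 2 := by
    have h0 : 0 ≤ γ * (x ⬝ᵥ x) := mul_nonneg hγ.le hxx
    exact pow_le_pow_left₀ h0 hc 2
  have h2 : γ ^ 2 * (x ⬝ᵥ x) * (x ⬝ᵥ x) ≤ (x ⬝ᵥ x) * (y ⬝ᵥ y) := by
    have := h1.trans hcs
    nlinarith [this]
  rcases hxx.eq_or_lt with hz | hpos
  · rw [← hz]; simp [Literature.LinearAlgebra.Matrix.dotProduct_self_nonneg_real y]
  · nlinarith [h2, hpos, Literature.LinearAlgebra.Matrix.dotProduct_self_nonneg_real y]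

omit [DecidableEq n] in
/-- `(M *ᵥ e_j) i = M i j`. [folklore] -/
theorem mulVec_single_one_apply [DecidableEq n] (M : Matrix n n ℝ) (i j : n) :
    (M *ᵥ Pi.single j (1 : ℝ)) i = M i j := by
  simp [Matrix.mulVec, dotProduct, Pi.single_apply]

/-- **1.** Entries of the inverse of a coercive matrix are bounded by `γ⁻¹`. [folklore] -/
theorem inv_entry_le_of_coercive {S : Matrix n n ℝ} {γ : ℝ} (hγ : 0 < γ) (h : Coercive S γ) (i j : n) :
    |S⁻¹ i j| ≤ γ⁻¹ := by
  have key := inv_mulVec_sq_le hγ h (Pi.single j (1 : ℝ))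
  set x := S⁻¹ *ᵥ Pi.single j (1 : ℝ) with hx
  have hxi : x i = S⁻¹ i j := by rw [hx]; exact mulVec_single_one_apply _ _ _
  have hee : (Pi.single j (1 : ℝ) : n → ℝ) ⬝ᵥ Pi.single j (1 : ℝ) = 1 := by
    simp
  rw [hee] at key
  have hxx : x i ^ 2 ≤ x ⬝ᵥ x := by
    have : x ⬝ᵥ x = ∑ k, x k ^ 2 := by simp only [dotProduct, pow_two]
    rw [this]
    exact Finset.single_le_sum (f := fun k => x k ^ 2) (fun k _ => sq_nonneg _) (Finset.mem_univ i)
  have h3 : (γ * x i) ^ 2 ≤ 1 := by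
    calc (γ * x i) ^ 2 = γ ^ 2 * x i ^ 2 := by ring
      _ ≤ γ ^ 2 * (x ⬝ᵥ x) := by gcongr
      _ ≤ 1 := key
  have h4 : |γ * x i| ≤ 1 := by
    have : |γ * x i| = Real.sqrt ((γ * x i) ^ 2) := (Real.sqrt_sq_eq_abs _).symm
    rw [this]
    calc Real.sqrt ((γ * x i) ^ 2) ≤ Real.sqrt 1 := Real.sqrt_le_sqrt h3
      _ = 1 := Real.sqrt_one
  rw [abs_mul, abs_of_pos hγ] at h4
  rw [← hxi]
  calc |x i| = γ⁻¹ * (γ * |x i|) := by field_simp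
    _ ≤ γ⁻¹ * 1 := by gcongr
    _ = γ⁻¹ := mul_one _

/-! ## Combes–Thomas conjugation -/

/-- The conjugated matrix `S_f = e^{f} S e^{−f}`, entrywise `e^{f i − f j} S i j`. [folklore] -/
noncomputable def conj (f : n → ℝ) (S : Matrix n n ℝ) : Matrix n n ℝ :=
  Matrix.of fun i j => Real.exp (f i - f j) * S i j

omit [Fintype n] [DecidableEq n] in
/-- Entries of the conjugated matrix (definitional unfolding). [folklore] -/
@[simp] theorem conj_apply (f : n → ℝ) (S : Matrix n n ℝ) (i j : n) :
    conj f S i j = Real.exp (f i - f j) * S i j := rfl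

/-- **2.** If `S_f` is coercive with constant `γ > 0` then `S` is invertible with
`|S⁻¹ i j| ≤ γ⁻¹ e^{−(f i − f j)}`: indeed `S⁻¹ = e^{−f} S_f⁻¹ e^{f}`. [folklore] -/
theorem inv_entry_le_of_conj_coercive {S : Matrix n n ℝ} {f : n → ℝ} {γ : ℝ} (hγ : 0 < γ)
    (h : Coercive (conj f S) γ) (i j : n) :
    |S⁻¹ i j| ≤ γ⁻¹ * Real.exp (-(f i - f j)) := by
  set T := conj f S with hT
  have hU : IsUnit T.det := (Matrix.isUnit_iff_isUnit_det T).mp (isUnit_of_coercive hγ h)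
  -- the candidate inverse of S
  set M : Matrix n n ℝ := Matrix.of fun a b => Real.exp (-f a) * T⁻¹ a b * Real.exp (f b) with hM
  have hMS : M * S = 1 := by
    have hTT : T⁻¹ * T = 1 := Matrix.nonsing_inv_mul T hU
    ext a c
    have hS : ∀ b, S b c = Real.exp (-f b) * Real.exp (f c) * T b c := by
      intro b
      rw [hT, conj_apply]
      rw [show Real.exp (-f b) * Real.exp (f c) * (Real.exp (f b - f c) * S b c)
          = (Real.exp (-f b) * Real.exp (f c) * Real.exp (f b - f c)) * S b c by ring]
      rw [← Real.exp_add, ← Real.exp_add]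
      simp
    have e1 : (M * S) a c = Real.exp (-f a) * Real.exp (f c) * (T⁻¹ * T) a c := by
      simp only [Matrix.mul_apply, hM, Matrix.of_apply]
      rw [Finset.mul_sum]
      refine Finset.sum_congr rfl fun b _ => ?_
      rw [hS b]
      have : Real.exp (f b) * Real.exp (-f b) = 1 := by rw [← Real.exp_add]; simp
      calc Real.exp (-f a) * T⁻¹ a b * Real.exp (f b) * (Real.exp (-f b) * Real.exp (f c) * T b c)
          = Real.exp (-f a) * Real.exp (f c) * (T⁻¹ a b * T b c) * (Real.exp (f b) * Real.exp (-f b)) := by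
            ring
        _ = Real.exp (-f a) * Real.exp (f c) * (T⁻¹ a b * T b c) := by rw [this, mul_one]
    rw [e1, hTT]
    by_cases hac : a = c
    · subst hac
      rw [Matrix.one_apply_eq, ← Real.exp_add]
      simp
    · rw [Matrix.one_apply_ne hac, mul_zero]
  have hinv : S⁻¹ = M := Matrix.inv_eq_left_inv hMS
  rw [hinv, hM, Matrix.of_apply]
  have hb := inv_entry_le_of_coercive hγ h i j
  rw [abs_mul, abs_mul, Real.abs_exp, Real.abs_exp]
  calc Real.exp (-f i) * |T⁻¹ i j| * Real.exp (f j)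
      ≤ Real.exp (-f i) * γ⁻¹ * Real.exp (f j) := by gcongr
    _ = γ⁻¹ * Real.exp (-(f i - f j)) := by
        rw [show -(f i - f j) = -f i + f j by ring, Real.exp_add]; ring

/-! ## Perturbative coercivity and the finite Schur test in quadratic-form form -/

omit [DecidableEq n] in
/-- Coercivity survives a form-small perturbation. [folklore] -/
theorem coercive_of_form_perturbation {S T : Matrix n n ℝ} {γ ρ : ℝ} (hS : Coercive S γ)
    (hE : ∀ x : n → ℝ, |x ⬝ᵥ ((T - S) *ᵥ x)| ≤ ρ * (x ⬝ᵥ x)) : Coercive T (γ - ρ) := by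
  intro x
  have h1 := hS x
  have h2 := hE x
  have e : x ⬝ᵥ (T *ᵥ x) = x ⬝ᵥ (S *ᵥ x) + x ⬝ᵥ ((T - S) *ᵥ x) := by
    rw [Matrix.sub_mulVec, dotProduct_sub]; ring
  rw [e]
  have h3 : -(ρ * (x ⬝ᵥ x)) ≤ x ⬝ᵥ ((T - S) *ᵥ x) := by
    have := neg_abs_le (x ⬝ᵥ ((T - S) *ᵥ x))
    linarith
  linarith

omit [DecidableEq n] in
/-- **3.** Finite Schur test, quadratic-form version: absolute row sums ≤ R, column sums ≤ C, `R C ≤ ρ²`, `0 ≤ ρ`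
imply `|⟨x, Ex⟩| ≤ ρ ‖x‖²`. [folklore] -/
theorem form_abs_le_of_schur (E : Matrix n n ℝ) {R C ρ : ℝ} (hρ : 0 ≤ ρ) (hRC : R * C ≤ ρ ^ 2)
    (hR : ∀ i, ∑ j, |E i j| ≤ R) (hC : ∀ j, ∑ i, |E i j| ≤ C) (x : n → ℝ) :
    |x ⬝ᵥ (E *ᵥ x)| ≤ ρ * (x ⬝ᵥ x) := by
  have hxx : 0 ≤ x ⬝ᵥ x := Literature.LinearAlgebra.Matrix.dotProduct_self_nonneg_real x
  have hEx : (E *ᵥ x) ⬝ᵥ (E *ᵥ x) ≤ R * C * (x ⬝ᵥ x) := by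
    have h := SchurTest.sum_sq_le (fun i j => E i j) x hR hC
    have e1 : (E *ᵥ x) ⬝ᵥ (E *ᵥ x) = ∑ i, (∑ j, E i j * x j) ^ 2 := by
      simp only [dotProduct, Matrix.mulVec, pow_two]
    have e2 : x ⬝ᵥ x = ∑ j, x j ^ 2 := by simp only [dotProduct, pow_two]
    rw [e1, e2]; exact h
  have hcs : (x ⬝ᵥ (E *ᵥ x)) ^ 2 ≤ (x ⬝ᵥ x) * ((E *ᵥ x) ⬝ᵥ (E *ᵥ x)) := B9Thm311.dot_sq_le _ _
  have h1 : (x ⬝ᵥ (E *ᵥ x)) ^ 2 ≤ (ρ * (x ⬝ᵥ x)) ^ 2 := by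
    calc (x ⬝ᵥ (E *ᵥ x)) ^ 2 ≤ (x ⬝ᵥ x) * ((E *ᵥ x) ⬝ᵥ (E *ᵥ x)) := hcs
      _ ≤ (x ⬝ᵥ x) * (R * C * (x ⬝ᵥ x)) := by gcongr
      _ ≤ (x ⬝ᵥ x) * (ρ ^ 2 * (x ⬝ᵥ x)) := by gcongr
      _ = (ρ * (x ⬝ᵥ x)) ^ 2 := by ring
  have h0 : 0 ≤ ρ * (x ⬝ᵥ x) := mul_nonneg hρ hxx
  calc |x ⬝ᵥ (E *ᵥ x)| = Real.sqrt ((x ⬝ᵥ (E *ᵥ x)) ^ 2) := (Real.sqrt_sq_eq_abs _).symm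
    _ ≤ Real.sqrt ((ρ * (x ⬝ᵥ x)) ^ 2) := Real.sqrt_le_sqrt h1
    _ = ρ * (x ⬝ᵥ x) := Real.sqrt_sq h0

/-! ## The mechanism: coercivity + exponentially weighted row/column sums ⇒ decay of the inverse kernel -/

/-- **4. Decay of the inverse of a coercive, exponentially localised matrix (finite Combes–Thomas).**
`S` coercive with `γ`; `d` a pseudo-metric (nonnegative, symmetric, zero diagonal, triangle inequality); the
`e^{κ d}−1`-weighted absolute row and column sums of `S` are ≤ ρ with `ρ < γ`.  Then
`|S⁻¹ i j| ≤ (γ − ρ)⁻¹ e^{−κ d(i,j)}`.  In the written repair `S` = the normalised `D^{−1}W^{1/2}(QGQ*)W^{1/2}D^{−1}`,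
`d` = the multiscale distance of B6 (2.46), and the weighted sums are bounded through B9 Thm 3.3 + B6 Lemma 2.1
(2.61); un-normalising gives the (3.132)-shape `O(1)(L^jη)^{−2}(L^{j′}η)^{−d}e^{−δ₁d(y,y′)}` with `δ₁ = κ` up to the
(2.60) absorption. [folklore] -/
theorem inverse_decay (S : Matrix n n ℝ) (d : n → n → ℝ) {γ κ ρ : ℝ}
    (hργ : ρ < γ) (hκ : 0 ≤ κ) (hS : Coercive S γ)
    (hd_symm : ∀ i j, d i j = d j i) (hd_zero : ∀ i, d i i = 0)
    (hd_tri : ∀ i j k, d i k ≤ d i j + d j k)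
    (hrow : ∀ i, ∑ j, |S i j| * (Real.exp (κ * d i j) - 1) ≤ ρ)
    (hcol : ∀ j, ∑ i, |S i j| * (Real.exp (κ * d i j) - 1) ≤ ρ) (i j : n) :
    |S⁻¹ i j| ≤ (γ - ρ)⁻¹ * Real.exp (-(κ * d i j)) := by
  -- weight function: κ · (distance to the target column j)
  set f : n → ℝ := fun a => κ * d a j with hf
  have hρ0 : 0 ≤ ρ := by
    have := hrow i
    refine le_trans (Finset.sum_nonneg fun b _ => ?_) this
    refine mul_nonneg (abs_nonneg _) ?_
    have hdn : 0 ≤ d i b := by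
      have := hd_tri i b i
      rw [hd_zero, hd_symm b i] at this; linarith
    have : (1 : ℝ) ≤ Real.exp (κ * d i b) := by
      have := Real.exp_le_exp.mpr (mul_nonneg hκ hdn)
      rwa [Real.exp_zero] at this
    linarith
  -- Lipschitz property of f
  have hLip : ∀ a b, |f a - f b| ≤ κ * d a b := by
    intro a b
    simp only [hf]
    rw [← mul_sub, abs_mul, abs_of_nonneg hκ]
    refine mul_le_mul_of_nonneg_left ?_ hκ
    rw [abs_le]
    constructor
    · have := hd_tri b a j
      rw [hd_symm b a] at this; linarith
    · have := hd_tri a b j; linarith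
  -- `|e^t − 1| ≤ e^{|t|} − 1` (elementary; the tree has it as
  -- `Literature.Geometry.Lorentzian.Deformation.abs_exp_sub_one_le_exp_abs_sub_one`, not imported here to keep this
  -- module free of the Lorentzian-geometry import chain)
  have abs_exp_sub_one_le : ∀ t : ℝ, |Real.exp t - 1| ≤ Real.exp |t| - 1 := by
    intro t
    rcases le_or_gt 0 t with ht | ht
    · rw [abs_of_nonneg ht, abs_of_nonneg (by linarith [Real.add_one_le_exp t])]
    · rw [abs_of_neg ht]
      have h1 : Real.exp t - 1 < 0 := by
        have := Real.exp_lt_exp.mpr ht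
        rw [Real.exp_zero] at this; linarith
      rw [abs_of_neg h1]
      have hc := Real.one_le_cosh t
      rw [Real.cosh_eq] at hc
      linarith
  -- entries of the perturbation conj f S − S
  have hEnt : ∀ a b, |(conj f S - S) a b| ≤ |S a b| * (Real.exp (κ * d a b) - 1) := by
    intro a b
    rw [Matrix.sub_apply, conj_apply]
    rw [show Real.exp (f a - f b) * S a b - S a b = (Real.exp (f a - f b) - 1) * S a b by ring,
      abs_mul, mul_comm]
    refine mul_le_mul_of_nonneg_left ?_ (abs_nonneg _)
    calc |Real.exp (f a - f b) - 1| ≤ Real.exp |f a - f b| - 1 := abs_exp_sub_one_le _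
      _ ≤ Real.exp (κ * d a b) - 1 := by
          have := Real.exp_le_exp.mpr (hLip a b); linarith
  have hR : ∀ a, ∑ b, |(conj f S - S) a b| ≤ ρ := fun a =>
    le_trans (Finset.sum_le_sum fun b _ => hEnt a b) (hrow a)
  have hC : ∀ b, ∑ a, |(conj f S - S) a b| ≤ ρ := fun b =>
    le_trans (Finset.sum_le_sum fun a _ => hEnt a b) (hcol b)
  have hform := form_abs_le_of_schur (conj f S - S) hρ0 (le_of_eq (by ring)) hR hC
  have hT : Coercive (conj f S) (γ - ρ) := coercive_of_form_perturbation hS hform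
  have hb := inv_entry_le_of_conj_coercive (by linarith) hT i j
  have hfij : f i - f j = κ * d i j := by simp only [hf]; rw [hd_zero, mul_zero, sub_zero]
  rw [hfij] at hb
  exact hb

/-! ## The variational lower bound (Schur-complement principle) -/

section variational

variable {m : Type*} [Fintype m] [DecidableEq m]

/-- **5a.** For a symmetric `Δ` with nonnegative form and inverse `Δ⁻¹` (`Δ` a unit): for every test vector `A`,
`2⟨A, μ⟩ − ⟨A, ΔA⟩ ≤ ⟨μ, Δ⁻¹μ⟩` (expand `0 ≤ ⟨A − Δ⁻¹μ, Δ(A − Δ⁻¹μ)⟩`). [folklore] -/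
theorem two_dot_sub_form_le_inv_form (Δ : Matrix m m ℝ) (hsymm : Δ.IsSymm) (hunit : IsUnit Δ)
    (hpos : ∀ v : m → ℝ, 0 ≤ v ⬝ᵥ (Δ *ᵥ v)) (A μ : m → ℝ) :
    2 * (A ⬝ᵥ μ) - A ⬝ᵥ (Δ *ᵥ A) ≤ μ ⬝ᵥ (Δ⁻¹ *ᵥ μ) := by
  have hU : IsUnit Δ.det := (Matrix.isUnit_iff_isUnit_det Δ).mp hunit
  set w := Δ⁻¹ *ᵥ μ with hw
  have hΔw : Δ *ᵥ w = μ := by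
    rw [hw, Matrix.mulVec_mulVec, Matrix.mul_nonsing_inv Δ hU, Matrix.one_mulVec]
  -- symmetry: u ⬝ (Δ v) = (Δ u) ⬝ v
  have hsym : ∀ u v : m → ℝ, u ⬝ᵥ (Δ *ᵥ v) = (Δ *ᵥ u) ⬝ᵥ v := by
    intro u v
    rw [Matrix.dotProduct_mulVec, ← Matrix.mulVec_transpose, hsymm.eq]
  have h0 := hpos (A - w)
  have e : (A - w) ⬝ᵥ (Δ *ᵥ (A - w))
      = A ⬝ᵥ (Δ *ᵥ A) - 2 * (A ⬝ᵥ μ) + μ ⬝ᵥ w := by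
    rw [Matrix.mulVec_sub, hΔw, sub_dotProduct, dotProduct_sub, dotProduct_sub]
    have e1 : w ⬝ᵥ (Δ *ᵥ A) = μ ⬝ᵥ A := by rw [hsym, hΔw]
    rw [e1, dotProduct_comm μ A, dotProduct_comm w μ]
    ring
  rw [e] at h0
  linarith

/-- **5b.** With `μ = Qᵀλ`: `2⟨QA, λ⟩ − ⟨A, ΔA⟩ ≤ ⟨λ, (QΔ⁻¹Qᵀ)λ⟩` for every test field `A`.  This is how the
written repair bounds the normalised QGQ* from BELOW using only an UPPER bound on ⟨A, Δ_aA⟩ for one explicit test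
field per λ (an approximate smooth right inverse of Q). [folklore] -/
theorem qgq_form_lower_of_test {p : Type*} [Fintype p] (Δ : Matrix m m ℝ) (hsymm : Δ.IsSymm)
    (hunit : IsUnit Δ) (hpos : ∀ v : m → ℝ, 0 ≤ v ⬝ᵥ (Δ *ᵥ v)) (Q : Matrix p m ℝ)
    (A : m → ℝ) (lam : p → ℝ) :
    2 * ((Q *ᵥ A) ⬝ᵥ lam) - A ⬝ᵥ (Δ *ᵥ A) ≤ lam ⬝ᵥ ((Q * Δ⁻¹ * Qᵀ) *ᵥ lam) := by
  have h := two_dot_sub_form_le_inv_form Δ hsymm hunit hpos A (Qᵀ *ᵥ lam)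
  have e1 : A ⬝ᵥ (Qᵀ *ᵥ lam) = (Q *ᵥ A) ⬝ᵥ lam := by
    rw [Matrix.mulVec_transpose, dotProduct_comm, ← Matrix.dotProduct_mulVec, dotProduct_comm]
  have e2 : lam ⬝ᵥ ((Q * Δ⁻¹ * Qᵀ) *ᵥ lam) = (Qᵀ *ᵥ lam) ⬝ᵥ (Δ⁻¹ *ᵥ (Qᵀ *ᵥ lam)) := by
    rw [← Matrix.mulVec_mulVec, ← Matrix.mulVec_mulVec, Matrix.dotProduct_mulVec lam Q,
      ← Matrix.mulVec_transpose]
  rw [e1, ← e2] at h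
  exact h

/-- **5c.** Consequently an explicit test family certifies coercivity: if for every λ there is a test field
`T λ` with `2⟨Q(Tλ), λ⟩ − ⟨Tλ, Δ(Tλ)⟩ ≥ γ‖λ‖²`, then `QΔ⁻¹Qᵀ` is coercive with `γ`. [folklore] -/
theorem qgq_coercive_of_test_family {p : Type*} [Fintype p] (Δ : Matrix m m ℝ) (hsymm : Δ.IsSymm)
    (hunit : IsUnit Δ) (hpos : ∀ v : m → ℝ, 0 ≤ v ⬝ᵥ (Δ *ᵥ v)) (Q : Matrix p m ℝ) (γ : ℝ)
    (T : (p → ℝ) → (m → ℝ))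
    (hT : ∀ lam : p → ℝ, γ * (lam ⬝ᵥ lam) ≤ 2 * ((Q *ᵥ T lam) ⬝ᵥ lam) - (T lam) ⬝ᵥ (Δ *ᵥ T lam)) :
    Coercive (Q * Δ⁻¹ * Qᵀ) γ :=
  fun lam => (hT lam).trans (qgq_form_lower_of_test Δ hsymm hunit hpos Q (T lam) lam)

/-- **5d. Approximate right inverse ⇒ coercivity** (the exact shape of Lemma P′ of the written repair, in normalised
coordinates): if a linear test map `T` satisfies `⟨QTλ, λ⟩ ≥ (1 − θ)‖λ‖²` (i.e. `QT = I + E`, `‖E‖ ≤ θ`) and the energy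
bound `⟨Tλ, ΔTλ⟩ ≤ C‖λ‖²` with `C > 0`, `θ ≤ 1`, then `QΔ⁻¹Qᵀ` is coercive with constant `(1 − θ)²/C` (optimise the
amplitude: test field `((1 − θ)/C) • Tλ`). [folklore] -/
theorem qgq_coercive_of_approx_right_inverse {p : Type*} [Fintype p] (Δ : Matrix m m ℝ) (hsymm : Δ.IsSymm)
    (hunit : IsUnit Δ) (hpos : ∀ v : m → ℝ, 0 ≤ v ⬝ᵥ (Δ *ᵥ v)) (Q : Matrix p m ℝ) {θ C : ℝ} (hC : 0 < C)
    (hθ : θ ≤ 1) (T : (p → ℝ) → (m → ℝ))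
    (hQT : ∀ lam : p → ℝ, (1 - θ) * (lam ⬝ᵥ lam) ≤ (Q *ᵥ T lam) ⬝ᵥ lam)
    (hE : ∀ lam : p → ℝ, (T lam) ⬝ᵥ (Δ *ᵥ T lam) ≤ C * (lam ⬝ᵥ lam)) :
    Coercive (Q * Δ⁻¹ * Qᵀ) ((1 - θ) ^ 2 / C) := by
  refine qgq_coercive_of_test_family Δ hsymm hunit hpos Q _ (fun lam => ((1 - θ) / C) • T lam) ?_
  intro lam
  have h1 := hQT lam
  have h2 := hE lam
  have hll : 0 ≤ lam ⬝ᵥ lam := Literature.LinearAlgebra.Matrix.dotProduct_self_nonneg_real lam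
  have e1 : (Q *ᵥ ((1 - θ) / C) • T lam) ⬝ᵥ lam = ((1 - θ) / C) * ((Q *ᵥ T lam) ⬝ᵥ lam) := by
    rw [Matrix.mulVec_smul, smul_dotProduct, smul_eq_mul]
  have e2 : (((1 - θ) / C) • T lam) ⬝ᵥ (Δ *ᵥ ((1 - θ) / C) • T lam)
      = ((1 - θ) / C) ^ 2 * ((T lam) ⬝ᵥ (Δ *ᵥ T lam)) := by
    rw [Matrix.mulVec_smul, smul_dotProduct, dotProduct_smul, smul_eq_mul, smul_eq_mul]; ring
  rw [e1, e2]
  have h1' : ((1 - θ) / C) * ((1 - θ) * (lam ⬝ᵥ lam)) ≤ ((1 - θ) / C) * ((Q *ᵥ T lam) ⬝ᵥ lam) :=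
    mul_le_mul_of_nonneg_left h1 (div_nonneg (by linarith) hC.le)
  have h2' : ((1 - θ) / C) ^ 2 * ((T lam) ⬝ᵥ (Δ *ᵥ T lam)) ≤ ((1 - θ) / C) ^ 2 * (C * (lam ⬝ᵥ lam)) :=
    mul_le_mul_of_nonneg_left h2 (sq_nonneg _)
  have e3 : (1 - θ) ^ 2 / C * (lam ⬝ᵥ lam)
      = 2 * (((1 - θ) / C) * ((1 - θ) * (lam ⬝ᵥ lam))) - ((1 - θ) / C) ^ 2 * (C * (lam ⬝ᵥ lam)) := by
    field_simp; ring
  rw [e3]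
  linarith

end variational

end Literature.MathematicalPhysics.QuantumFieldTheory.Balaban1983to89.QGQInverse
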